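import Summits.ValiantsHypothesis.ValiantsHypothesis.Theorems.SymPencilPerFourHessianRankThreeZero
import Summits.ValiantsHypothesis.ValiantsHypothesis.Theorems.SymPencilBoxFourEquality
import Mathlib.LinearAlgebra.Dual.Lemmas

/-!
# Route `SymPencil` — Hessian rank `≤ 5` on a `7`-dimensional singular subspace: reduction to
# the toric case (dispatcher of Task T1 of `Cruxes/SdcSuperquadratic/NEXT-RUNG-23.md`;
# `--supports` stmt-ValiantsHypothesis-5674 `SdcSuperquadratic`)

Let `W` be a subspace of `4 × 4` matrices on which all `3 × 3` subpermanents vanish (H3) and with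
the swapped property with `< 6` squares (`rank (Hess per_4) ≤ 5` on `W`).  If `dim W ≥ 7` then
every row maps `W` onto a space of dimension `≤ 2` (`finrank_map_row_le_two`): a row of rank `4`
is Case A (`SymPencilPerFourHessianRowControl`), a row of rank `3` has image a hyperplane `ker φ`,
and the number of non-zero coefficients of `φ` selects Case B1 (`≥ 3`: the row is generic,
`SymPencilPerFourHessianColControl.finrank_le_four_of_row_generic`), B2 (`= 2`: two proportional
cells, `SymPencilPerFourHessianRankThreeProp`) or B3 (`= 1`: a zero cell,
`SymPencilPerFourHessianRankThreeZero`) — each giving `dim W ≤ 6`.  By transposition the same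
holds for columns (`finrank_map_col_le_two`).  Hence (`finrank_le_six_of_toric`):

  **`dim W ≤ 6`, PROVIDED the toric case is excluded**: if all rows and all columns of `W` have
  rank `≤ 2` then `dim W ≤ 6` (hypothesis `hC`, Case C of the note — NOT proved here).

Honest framing: a CONDITIONAL reduction (Case C remains); nothing here changes `sdc(per_4) ≥ 23`;
the crux stays open; `VP ≠ VNP` is not moved. [folklore]
-/

noncomputable section

-- single-conjunct layout: Sub = Summit, duplicated namespace component intended
set_option linter.dupNamespace false

namespace Summit.ValiantsHypothesis.ValiantsHypothesis.Theorems.SymPencilPerFourHessianRankDispatch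

open Matrix MvPolynomial Finset Module
open Literature.Computability.AlgebraicComplexity
open Literature.Computability.AlgebraicComplexity.AlperBogartVelasco
open Summit.ValiantsHypothesis.ValiantsHypothesis.Theorems.SymPencilPerFourHessianMinors
open Summit.ValiantsHypothesis.ValiantsHypothesis.Theorems.SymPencilPerFourHessianRowControl
open Summit.ValiantsHypothesis.ValiantsHypothesis.Theorems.SymPencilPerFourHessianColControl
open Summit.ValiantsHypothesis.ValiantsHypothesis.Theorems.SymPencilPerFourHessianRankThreeProp
open Summit.ValiantsHypothesis.ValiantsHypothesis.Theorems.SymPencilPerFourHessianRankThreeZero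
open Summit.ValiantsHypothesis.ValiantsHypothesis.Theorems.SymPencilBoxFourEquality

variable {K : Type*} [Field K]

/-- **Rows have rank `≤ 2` when `dim W ≥ 7`.**  See the module docstring. [folklore] -/
theorem finrank_map_row_le_two [CharZero K] {ι : Type*} [Fintype ι] (hι : Fintype.card ι < 6)
    (W : Submodule K (Fin 4 × Fin 4 → K))
    (hW3 : ∀ x ∈ W, ∀ (r c : Fin 3 → Fin 4), Function.Injective r → Function.Injective c →
      ((Matrix.of fun i j => x (i, j)).submatrix r c).permanent = 0)
    (hW : ∀ y ∈ W, ∃ (c : ι → K) (Λ : ι → ((Fin 4 × Fin 4 → K) →ₗ[K] K)),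
      ∀ u : Fin 4 × Fin 4 → K, ∃ e₀ e₁ : K, ∀ s : K,
        eval (u + s • y) (perPoly (Fin 4) K) = e₀ + s * e₁ + s ^ 2 * ∑ k, c k * (Λ k u) ^ 2)
    (h7 : 7 ≤ finrank K W) (a : Fin 4) :
    finrank K (W.map (LinearMap.funLeft K K fun j : Fin 4 => (a, j))) ≤ 2 := by
  classical
  set ρ : (Fin 4 × Fin 4 → K) →ₗ[K] (Fin 4 → K) := LinearMap.funLeft K K fun j : Fin 4 => (a, j)
    with hρdef
  have hρ : ∀ x j, ρ x j = x (a, j) := fun _ _ => rfl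
  by_contra hgt
  push Not at hgt
  have hle4 : finrank K (W.map ρ) ≤ 4 := by
    have := Submodule.finrank_le (W.map ρ)
    rwa [Module.finrank_fintype_fun_eq_card, Fintype.card_fin] at this
  by_cases h4 : finrank K (W.map ρ) = 4
  · -- Case A: the row is onto
    have htop : W.map ρ = ⊤ := Submodule.eq_top_of_finrank_eq (by
      rw [h4, Module.finrank_fintype_fun_eq_card, Fintype.card_fin])
    have honto : ∀ v : Fin 4 → K, ∃ z ∈ W, ∀ j, z (a, j) = v j := fun v => by
      have hv : v ∈ W.map ρ := by rw [htop]; exact Submodule.mem_top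
      obtain ⟨z, hz, hzv⟩ := hv
      exact ⟨z, hz, fun j => by have := congr_fun hzv j; rwa [hρ] at this⟩
    have := finrank_le_four_of_row_onto hι W hW a honto
    omega
  -- rank `3`: the image is a hyperplane `ker φ`
  have h3 : finrank K (W.map ρ) = 3 := by omega
  have hlt : W.map ρ < ⊤ := by
    refine lt_of_le_of_ne le_top fun h => h4 ?_
    rw [h, finrank_top, Module.finrank_fintype_fun_eq_card, Fintype.card_fin]
  obtain ⟨x₀, hx₀⟩ : ∃ x₀ : Fin 4 → K, x₀ ∉ W.map ρ := by
    by_contra h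
    push Not at h
    exact (lt_top_iff_ne_top.1 hlt) (eq_top_iff.2 fun x _ => h x)
  obtain ⟨φ, hφ0, hφW⟩ := Submodule.exists_dual_map_eq_bot_of_notMem hx₀ inferInstance
  rw [← LinearMap.le_ker_iff_map] at hφW
  have hker3 : finrank K (LinearMap.ker φ) = 3 := by
    have hφne : φ ≠ 0 := fun h => hφ0 (by rw [h, LinearMap.zero_apply])
    have h1 : finrank K (LinearMap.range φ) = 1 := by
      have hle : finrank K (LinearMap.range φ) ≤ 1 := by
        have := Submodule.finrank_le (LinearMap.range φ)
        rwa [Module.finrank_self] at this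
      have hpos : 0 < finrank K (LinearMap.range φ) := by
        rw [Module.finrank_pos_iff_exists_ne_zero]
        exact ⟨⟨φ x₀, x₀, rfl⟩, fun h => hφ0 (Subtype.ext_iff.1 h)⟩
      omega
    have h := LinearMap.finrank_range_add_finrank_ker φ
    rw [Module.finrank_fintype_fun_eq_card, Fintype.card_fin] at h
    omega
  have heq : W.map ρ = LinearMap.ker φ := Submodule.eq_of_le_of_finrank_le hφW (by omega)
  -- realisation: every `v ∈ ker φ` is a row `a` of some element of `W`
  have hreal : ∀ v : Fin 4 → K, φ v = 0 → ∃ z ∈ W, ∀ j, z (a, j) = v j := by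
    intro v hv
    have : v ∈ W.map ρ := by rw [heq, LinearMap.mem_ker]; exact hv
    obtain ⟨z, hz, hzv⟩ := this
    exact ⟨z, hz, fun j => by have := congr_fun hzv j; rwa [hρ] at this⟩
  -- the row relation: `Σ_j κ_j x_{aj} = 0` on `W`, `κ_j = φ e_j`
  set κ : Fin 4 → K := fun j => φ (Pi.single j 1) with hκ
  have hφv : ∀ v : Fin 4 → K, φ v = ∑ j, κ j * v j := by
    intro v
    conv_lhs => rw [show v = ∑ j, v j • (Pi.single j (1 : K) : Fin 4 → K) from by
      ext i; simp [Finset.sum_apply, Pi.single_apply]]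
    rw [map_sum]
    exact Finset.sum_congr rfl fun j _ => by rw [map_smul, smul_eq_mul, mul_comm]
  have hrel : ∀ x ∈ W, ∑ j, κ j * x (a, j) = 0 := by
    intro x hx
    have : ρ x ∈ W.map ρ := ⟨x, hx, rfl⟩
    rw [heq, LinearMap.mem_ker, hφv] at this
    exact this
  -- some `κ_{m₁} ≠ 0`
  obtain ⟨m₁, hm₁⟩ : ∃ m₁, κ m₁ ≠ 0 := by
    by_contra h
    push Not at h
    apply hφ0
    rw [hφv]
    exact Finset.sum_eq_zero fun j _ => by rw [h j, zero_mul]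
  by_cases hB3 : ∀ j, j ≠ m₁ → κ j = 0
  · -- Case B3: `x_{a m₁} ≡ 0`
    have hzero : ∀ x ∈ W, x (a, m₁) = 0 := by
      intro x hx
      have h := hrel x hx
      rw [Finset.sum_eq_single m₁ (fun j _ hj => by rw [hB3 j hj, zero_mul])
        (fun h => absurd (Finset.mem_univ _) h)] at h
      exact (mul_eq_zero.1 h).resolve_left hm₁
    have hreal' : ∀ v : Fin 4 → K, v m₁ = 0 → ∃ z ∈ W, ∀ j, z (a, j) = v j := by
      intro v hv
      apply hreal
      rw [hφv, Finset.sum_eq_single m₁ (fun j _ hj => by rw [hB3 j hj, zero_mul])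
        (fun h => absurd (Finset.mem_univ _) h), hv, mul_zero]
    have := finrank_le_six_of_zero_cell hι W hW3 hW a m₁ hzero hreal'
    omega
  push Not at hB3
  obtain ⟨m₂, hm₂₁, hm₂⟩ := hB3
  by_cases hB2 : ∀ j, j ≠ m₁ → j ≠ m₂ → κ j = 0
  · -- Case B2: `x_{a m₁} ≡ μ x_{a m₂}`, `μ = -κ₂/κ₁`
    set μ : K := -(κ m₂ / κ m₁) with hμdef
    have hμ : μ ≠ 0 := by
      rw [hμdef, neg_ne_zero]; exact div_ne_zero hm₂ hm₁
    have hsum2 : ∀ v : Fin 4 → K, ∑ j, κ j * v j = κ m₁ * v m₁ + κ m₂ * v m₂ := by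
      intro v
      rw [← Finset.sum_subset (Finset.subset_univ {m₁, m₂})
        (fun j _ hj => by
          rw [Finset.mem_insert, Finset.mem_singleton, not_or] at hj
          rw [hB2 j hj.1 hj.2, zero_mul]),
        Finset.sum_pair (Ne.symm hm₂₁)]
    have hprop : ∀ x ∈ W, x (a, m₁) = μ * x (a, m₂) := by
      intro x hx
      have h := hrel x hx
      rw [hsum2] at h
      rw [hμdef]
      field_simp
      linear_combination h
    have hreal' : ∀ v : Fin 4 → K, v m₁ = μ * v m₂ → ∃ z ∈ W, ∀ j, z (a, j) = v j := by
      intro v hv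
      apply hreal
      rw [hφv, hsum2, hv, hμdef]
      field_simp
      ring
    have := finrank_le_six_of_prop_pair hι W hW a m₁ m₂ hm₂₁.symm μ hμ hprop hreal'
    omega
  · -- Case B1: at least three non-zero coefficients: the row is generic
    push Not at hB2
    obtain ⟨m₃, hm₃₁, hm₃₂, hm₃⟩ := hB2
    have pick : ∀ m c a₁ a₂ a₃ : Fin 4, a₁ ≠ a₂ → a₁ ≠ a₃ → a₂ ≠ a₃ →
        (a₁ ≠ m ∧ a₁ ≠ c) ∨ (a₂ ≠ m ∧ a₂ ≠ c) ∨ (a₃ ≠ m ∧ a₃ ≠ c) := by decide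
    have hgen : ∀ m c : Fin 4, m ≠ c → ∃ z ∈ W, z (a, m) = 1 ∧ z (a, c) = 0 := by
      intro m c hmc
      obtain ⟨p, hpm, hpc, hp⟩ : ∃ p, p ≠ m ∧ p ≠ c ∧ κ p ≠ 0 := by
        rcases pick m c m₁ m₂ m₃ hm₂₁.symm hm₃₁.symm hm₃₂.symm with h | h | h
        · exact ⟨m₁, h.1, h.2, hm₁⟩
        · exact ⟨m₂, h.1, h.2, hm₂⟩
        · exact ⟨m₃, h.1, h.2, hm₃⟩
      set v : Fin 4 → K := Pi.single m 1 - (κ m / κ p) • Pi.single p 1 with hv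
      have hφv0 : φ v = 0 := by
        rw [hv, map_sub, map_smul, smul_eq_mul]
        change κ m - κ m / κ p * κ p = 0
        field_simp
        ring
      obtain ⟨z, hz, hzv⟩ := hreal v hφv0
      refine ⟨z, hz, ?_, ?_⟩
      · rw [hzv, hv, Pi.sub_apply, Pi.smul_apply, Pi.single_eq_same, Pi.single_eq_of_ne hpm.symm,
          smul_zero, sub_zero]
      · rw [hzv, hv, Pi.sub_apply, Pi.smul_apply, Pi.single_eq_of_ne hmc.symm,
          Pi.single_eq_of_ne hpc.symm, smul_zero, sub_zero]
    have := finrank_le_four_of_row_generic hι W hW a hgen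
    omega

/-- **Columns have rank `≤ 2` when `dim W ≥ 7`** (transpose of `finrank_map_row_le_two`).
[folklore] -/
theorem finrank_map_col_le_two [CharZero K] {ι : Type*} [Fintype ι] (hι : Fintype.card ι < 6)
    (W : Submodule K (Fin 4 × Fin 4 → K))
    (hW3 : ∀ x ∈ W, ∀ (r c : Fin 3 → Fin 4), Function.Injective r → Function.Injective c →
      ((Matrix.of fun i j => x (i, j)).submatrix r c).permanent = 0)
    (hW : ∀ y ∈ W, ∃ (c : ι → K) (Λ : ι → ((Fin 4 × Fin 4 → K) →ₗ[K] K)),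
      ∀ u : Fin 4 × Fin 4 → K, ∃ e₀ e₁ : K, ∀ s : K,
        eval (u + s • y) (perPoly (Fin 4) K) = e₀ + s * e₁ + s ^ 2 * ∑ k, c k * (Λ k u) ^ 2)
    (h7 : 7 ≤ finrank K W) (j : Fin 4) :
    finrank K (W.map (LinearMap.funLeft K K fun i : Fin 4 => (i, j))) ≤ 2 := by
  set τ := LinearEquiv.funCongrLeft K K (Equiv.prodComm (Fin 4) (Fin 4)) with hτ
  have h := finrank_map_row_le_two hι (W.map τ.toLinearMap) (subperm_vanish_transpose W hW3)
    (sum_sq_swap_transpose W hW) (by rw [LinearEquiv.finrank_map_eq]; exact h7) j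
  have hcomp : (LinearMap.funLeft K K fun j' : Fin 4 => (j, j')) ∘ₗ τ.toLinearMap =
      LinearMap.funLeft K K fun i : Fin 4 => (i, j) := by
    apply LinearMap.ext
    intro x
    funext i
    rfl
  rwa [← Submodule.map_comp, hcomp] at h

/-- **Reduction to the toric case.**  Under H3 and the swapped property with `< 6` squares:
`dim W ≤ 6`, provided that `dim W ≤ 6` holds whenever all rows and all columns of `W` have rank
`≤ 2` (Case C of the note, taken as the hypothesis `hC`). [folklore] -/
theorem finrank_le_six_of_toric [CharZero K] {ι : Type*} [Fintype ι] (hι : Fintype.card ι < 6)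
    (W : Submodule K (Fin 4 × Fin 4 → K))
    (hW3 : ∀ x ∈ W, ∀ (r c : Fin 3 → Fin 4), Function.Injective r → Function.Injective c →
      ((Matrix.of fun i j => x (i, j)).submatrix r c).permanent = 0)
    (hW : ∀ y ∈ W, ∃ (c : ι → K) (Λ : ι → ((Fin 4 × Fin 4 → K) →ₗ[K] K)),
      ∀ u : Fin 4 × Fin 4 → K, ∃ e₀ e₁ : K, ∀ s : K,
        eval (u + s • y) (perPoly (Fin 4) K) = e₀ + s * e₁ + s ^ 2 * ∑ k, c k * (Λ k u) ^ 2)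
    (hC : (∀ a : Fin 4, finrank K (W.map (LinearMap.funLeft K K fun j : Fin 4 => (a, j))) ≤ 2) →
      (∀ j : Fin 4, finrank K (W.map (LinearMap.funLeft K K fun i : Fin 4 => (i, j))) ≤ 2) →
      finrank K W ≤ 6) :
    finrank K W ≤ 6 := by
  by_contra h
  push Not at h
  have h7 : 7 ≤ finrank K W := by omega
  have := hC (fun a => finrank_map_row_le_two hι W hW3 hW h7 a)
    (fun j => finrank_map_col_le_two hι W hW3 hW h7 j)
  omega

end Summit.ValiantsHypothesis.ValiantsHypothesis.Theorems.SymPencilPerFourHessianRankDispatch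

end
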